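import Summits.CriticalPhenomena.PercolationContinuityZ3.Theorems.Transplant.FKConnectivityAllQCountReweightedCex
import Summits.CriticalPhenomena.PercolationContinuityZ3.Theorems.Transplant.FKConnectivityAllQCountReweightedNecessity
import HarnessLib

/-!
# Kozma–Nitzan's FOUR-POINT inequality under cluster-count reweighting: the 6-cycle is a TIGHT CELL for every FK measure, and
# `μ_h{oa|cb}·μ_h{oc|ab} ≤ μ_h{oab|c}·μ_h{ocb|a}` on it is EQUIVALENT to log-CONCAVITY of `h` at the middle level

Support file (`--supports stmt-CriticalPhenomena-4575`), FK sub-lane `prim-bschramm-fk-1` (gen 11) of the post-continuity programme;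
builds on p205010 (kernel theorem, internal audit signed; external expert review pending).  One `def` family (computable level masses on
listed weighted graphs) and one `abbrev` / four `def`s (the 6-cycle data set and its event predicates); no named facts, no sorries; standard
axioms (`decide +kernel` for the finite level masses only).  Nothing here bears on p205010.

CONTEXT.  fk-1 g4 typed the product form of Kozma–Nitzan's Theorem 1, `FourPointUnder μ o a c b`:
`μ{oa|cb}·μ{oc|ab} ≤ μ{oab|c}·μ{ocb|a}` (patterns induced by the open clusters on the source `o`, the relays `a, c`, the target `b`),
which gives ADDITIVE GLUING for relay sets of size `≤ 2` under ANY probability measure (`additiveGluingUnder_of_card_le_two`), and the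
node `FourPointFKPos` (all `φ_{w,q}`, `q > 0`; coefficientwise-verified on `K_6`).  fk-1 g9/g10 and cp-hp5 found by exact census
(n ≤ 6) that additive gluing holds under EVERY cluster-count reweighting `μ_h ∝ P_w·h(k)` (`AdditiveGluingCountPos`, open), while the
hub inequality holds exactly for LOG-CONVEX `h` (`logConvex_of_hub_all`: necessity on the 3-path, tight at FK).  This file locates the
four-point inequality in that landscape:
* **`fourPoint_c6_iff`** — on the 6-cycle `o–a–x–b–c–y–o` (source and target antipodal, the relays adjacent to the source) with all
  six parameters `½`, for every positive `h`:  `FourPointUnder (μ_h) o a c b ⟺ h(2)·h(4) ≤ h(3)²`.  Exactly: `x₃x₄ − x₆x₇ =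
  (h(3)² − h(2)h(4))/4096` (by level masses: `x₆ ∝ 4h(2)+4h(3)+h(4)`, `x₇ ∝ h(2)`, `x₃ = x₄ ∝ 2h(2)+h(3)`; for general `p` the factor is
  `p⁶(1−p)⁶`, seat census).  So the four-point inequality needs log-CONCAVITY where the hub inequality needs log-CONVEXITY, and the
  6-cycle is TIGHT (equality) for every random-cluster measure `h = q^k` (`fourPoint_c6_rcMeasureW`);
* **`not_fourPoint_count_factorial`**, **`not_fourPoint_count_all`** — the four-point inequality FAILS under `P_w·k!` (and under every
  `h` with `h(3)² < h(2)h(4)`), although additive gluing for `|A| ≤ 2` still holds there (census: margin `+1544·2⁻¹²` at `p = ½`): the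
  census-robustness of additive gluing is NOT explained by the product-form four-point inequality;
* **`geometric_of_hub_and_fourPoint`** (RIGIDITY at the witnessed level) — if both the hub inequality and the four-point inequality hold
  under `μ_h` on all weighted graphs on `≤ 6` vertices then `h(3)² = h(2)·h(4)`: combined with `logConvex_of_hub_all` the only count
  weights compatible with both links of the chain are log-linear there, i.e. random-cluster weights.
Seat census behind the statement (exact integers, work/numerics of the seat folder; memo bschramm/FROM-fk-1-g11-FOURPOINT.md): for
n ≤ 5 the four-point inequality holds for all 16 count weights tested and even entrywise in the pair of cluster counts (0/10,098,720),
the 6-cycle is the first obstruction; under PRODUCT measure the inequality holds FIBREWISE (coefficientwise in the edge variables ⟺ for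
the antithetic pair `(η, ηᶜ)` at `p = ½`) on every graph with `≤ 6` vertices (7,853 fibres of `K_6`, 0 violations, 5,998 tight).
[cite: KozmaNitzan2024, Thm. 1, eq. (6) (pp. 7–8); Conj. 1 (p. 3)] [cite: Grimmett2006, §1.4 eq. (1.20) (p. 15); §3.9 (pp. 63–65)]
[cite: VandenbergHaggstromKahn2005, Thms. 1.3, 1.4 (pp. 6–7)]
-/

namespace Summit.CriticalPhenomena.PercolationContinuityZ3.Theorems

namespace FK

open MeasureTheory Set Literature.Probability.LatticeModels Literature.Probability.Percolation
open Literature.Probability.Percolation.BHK2006 (weight)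
open Literature.Probability.Percolation.DecisionTree (ind ind_of_mem ind_of_not_mem)

namespace RCEval

variable (D : RCEval)

/-! ### Computable LEVEL masses of a listed weighted graph (symbolic count weights) -/

/-- **Level mass** of a computable event: `Σ_t [P t ∧ k(t) = j] wQ t` — the product-measure mass of the configurations in the event
with exactly `j` open clusters (computable, `decide +kernel`-evaluable). [cite: Grimmett2006, §1.4 eq. (1.20) (p. 15)] -/
def levQ (P : Finset (Fin D.m) → Bool) (j : ℕ) : ℚ :=
  ∑ t : Finset (Fin D.m), if P t = true ∧ D.kB t = j then D.wQ t else 0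

noncomputable section

open scoped Classical

variable {D}

/-- The count-reweighted weight of `conf t` for an ARBITRARY real count weight `h`: `wQ t · h(kB t)`.
[cite: Grimmett2006, §1.4 eq. (1.20) (p. 15)] -/
theorem crWeight_conf_real (hD : D.Valid) (h : ℕ → ℝ) (t : Finset (Fin D.m)) :
    crWeight D.w h (D.conf t) = (D.wQ t : ℝ) * h (D.kB t) := by
  unfold crWeight
  rw [weight_conf hD t, clusterCount_conf t]

/-- **Transfer for symbolic `h`**: `Σ_ω crWeight(ω)·f(ω) = Σ_t wQ t · h(kB t) · f(conf t)`. [cite: Grimmett2006, §1.4 eq. (1.20) (p. 15)] -/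
theorem sum_crWeight_mul_real (hD : D.Valid) (h : ℕ → ℝ) (f : BondConfig (Fin D.n) → ℝ) :
    ∑ ω : BondConfig (Fin D.n), crWeight D.w h ω * f ω =
      ∑ t : Finset (Fin D.m), (D.wQ t : ℝ) * h (D.kB t) * f (D.conf t) := by
  have hsub : Finset.univ.image D.conf ⊆ (Finset.univ : Finset (BondConfig (Fin D.n))) := Finset.subset_univ _
  rw [← Finset.sum_subset hsub]
  · rw [Finset.sum_image fun s _ t _ h => conf_injective hD h]
    exact Finset.sum_congr rfl fun t _ => by rw [crWeight_conf_real hD h t]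
  · intro ω _ hω
    have hω' : ¬ ω ⊆ Set.range D.edge := by
      intro h'
      obtain ⟨t, rfl⟩ := exists_conf_eq_of_subset h'
      exact hω (Finset.mem_image.2 ⟨t, Finset.mem_univ _, rfl⟩)
    unfold crWeight
    rw [weight_eq_zero_of_not_subset hω', zero_mul, zero_mul]

/-- The computable cluster count is at most the number of vertices. [folklore] -/
theorem kB_le (t : Finset (Fin D.m)) : D.kB t ≤ D.n := by
  unfold kB
  exact (Finset.card_filter_le _ _).trans (by simp)

/-- **The unnormalised mass of a computable event as a LEVEL SUM**: `Σ_ω crWeight(ω)·1_X(ω) = Σ_{j ≤ n} levQ P j · h(j)`.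
[cite: Grimmett2006, §1.4 eq. (1.20) (p. 15)] -/
theorem sum_crWeight_ind_eq_levels (hD : D.Valid) (h : ℕ → ℝ) {X : Set (BondConfig (Fin D.n))} {P : Finset (Fin D.m) → Bool}
    (hP : ∀ t, D.conf t ∈ X ↔ P t = true) :
    ∑ ω : BondConfig (Fin D.n), crWeight D.w h ω * ind X ω =
      ∑ j ∈ Finset.range (D.n + 1), (D.levQ P j : ℝ) * h j := by
  rw [sum_crWeight_mul_real hD h]
  unfold levQ
  push_cast
  simp_rw [Finset.sum_mul]
  rw [Finset.sum_comm]
  refine Finset.sum_congr rfl fun t _ => ?_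
  by_cases hPt : P t = true
  · rw [ind_of_mem ((hP t).2 hPt), mul_one]
    rw [Finset.sum_eq_single (D.kB t)]
    · simp [hPt]
    · intro j _ hj
      rw [if_neg (fun hc => hj hc.2.symm), Rat.cast_zero, zero_mul]
    · intro hk
      exact absurd (Finset.mem_range.2 (Nat.lt_succ_of_le (kB_le t))) hk
  · rw [ind_of_not_mem (fun hX => hPt ((hP t).1 hX)), mul_zero]
    symm
    exact Finset.sum_eq_zero fun j _ => by rw [if_neg (fun hc => hPt hc.1), Rat.cast_zero, zero_mul]

/-- **The measure of a computable event for a symbolic count weight**: `μ_{w,h}(X) = (Σ_j levQ P j · h j) / Z_h` (`h > 0`).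
[cite: Grimmett2006, §1.4 eq. (1.20) (p. 15)] -/
theorem cr_real_eq_levels_div (hD : D.Valid) {h : ℕ → ℝ} (hpos : ∀ k, 0 < h k) {X : Set (BondConfig (Fin D.n))}
    {P : Finset (Fin D.m) → Bool} (hP : ∀ t, D.conf t ∈ X ↔ P t = true) :
    (crMeasure D.w h).real X = (∑ j ∈ Finset.range (D.n + 1), (D.levQ P j : ℝ) * h j) / crPartition D.w h := by
  rw [crMeasure_real_eq_sum_div D.w hpos X, sum_crWeight_ind_eq_levels hD h hP]

end

end RCEval

/-! ### The 6-cycle `o–a–x–b–c–y–o`: level masses of the four patterns -/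

namespace FourPointC6

/-- The 6-cycle `0–1–4–3–2–5–0` on `Fin 6` with all parameters `½` (source `o = 0`, relays `a = 1`, `c = 2`, target `b = 3`;
`q` is not used by `crMeasure`). [cite: Grimmett2006, §1.4 eq. (1.20) (p. 15)] -/
abbrev c6 : RCEval := ⟨6, 6, ![0, 1, 3, 2, 2, 0], ![1, 4, 4, 3, 5, 5], ![1 / 2, 1 / 2, 1 / 2, 1 / 2, 1 / 2, 1 / 2], 1⟩

/-- Validity of the data set. [folklore] -/
theorem valid : c6.Valid := by decide +kernel

/-- Computable predicate of `{oa|cb} = {0↔1} ∩ {3↔2} ∩ {1↮2}`. [folklore] -/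
def p6 (t : Finset (Fin 6)) : Bool := (c6.reachB t 0 1 && c6.reachB t 3 2) && !(c6.reachB t 1 2)
/-- Computable predicate of `{oc|ab} = {0↔2} ∩ {3↔1} ∩ {1↮2}`. [folklore] -/
def p7 (t : Finset (Fin 6)) : Bool := (c6.reachB t 0 2 && c6.reachB t 3 1) && !(c6.reachB t 1 2)
/-- Computable predicate of `{oab|c} = {0↔1} ∩ {3↔1} ∩ {1↮2}`. [folklore] -/
def p3 (t : Finset (Fin 6)) : Bool := (c6.reachB t 0 1 && c6.reachB t 3 1) && !(c6.reachB t 1 2)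
/-- Computable predicate of `{ocb|a} = {0↔2} ∩ {3↔2} ∩ {1↮2}`. [folklore] -/
def p4 (t : Finset (Fin 6)) : Bool := (c6.reachB t 0 2 && c6.reachB t 3 2) && !(c6.reachB t 1 2)

/-- Level masses of `{oa|cb}`: `k = 2: 4/64`, `k = 3: 4/64`, `k = 4: 1/64`. [cite: Grimmett2006, §1.4 eq. (1.20) (p. 15)] -/
theorem lev6 : c6.levQ p6 0 = 0 ∧ c6.levQ p6 1 = 0 ∧ c6.levQ p6 2 = 1 / 16 ∧ c6.levQ p6 3 = 1 / 16 ∧ c6.levQ p6 4 = 1 / 64 ∧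
    c6.levQ p6 5 = 0 ∧ c6.levQ p6 6 = 0 := by decide +kernel
/-- Level masses of `{oc|ab}`: `k = 2: 1/64`. [cite: Grimmett2006, §1.4 eq. (1.20) (p. 15)] -/
theorem lev7 : c6.levQ p7 0 = 0 ∧ c6.levQ p7 1 = 0 ∧ c6.levQ p7 2 = 1 / 64 ∧ c6.levQ p7 3 = 0 ∧ c6.levQ p7 4 = 0 ∧
    c6.levQ p7 5 = 0 ∧ c6.levQ p7 6 = 0 := by decide +kernel
/-- Level masses of `{oab|c}`: `k = 2: 2/64`, `k = 3: 1/64`. [cite: Grimmett2006, §1.4 eq. (1.20) (p. 15)] -/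
theorem lev3 : c6.levQ p3 0 = 0 ∧ c6.levQ p3 1 = 0 ∧ c6.levQ p3 2 = 1 / 32 ∧ c6.levQ p3 3 = 1 / 64 ∧ c6.levQ p3 4 = 0 ∧
    c6.levQ p3 5 = 0 ∧ c6.levQ p3 6 = 0 := by decide +kernel
/-- Level masses of `{ocb|a}`: `k = 2: 2/64`, `k = 3: 1/64`. [cite: Grimmett2006, §1.4 eq. (1.20) (p. 15)] -/
theorem lev4 : c6.levQ p4 0 = 0 ∧ c6.levQ p4 1 = 0 ∧ c6.levQ p4 2 = 1 / 32 ∧ c6.levQ p4 3 = 1 / 64 ∧ c6.levQ p4 4 = 0 ∧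
    c6.levQ p4 5 = 0 ∧ c6.levQ p4 6 = 0 := by decide +kernel

noncomputable section

open scoped Classical

/-- `conf t ∈ {oa|cb}` iff `p6`. [folklore] -/
theorem mem6 (t : Finset (Fin 6)) :
    c6.conf t ∈ openConn (0 : Fin 6) 1 ∩ openConn (3 : Fin 6) 2 ∩ (sepEv (1 : Fin 6) 2 : Set (BondConfig (Fin 6))) ↔
      p6 t = true := by
  unfold p6
  rw [Set.mem_inter_iff, Set.mem_inter_iff, mem_sepEv_iff, Bool.and_eq_true, Bool.and_eq_true, Bool.not_eq_true',
    ← Bool.not_eq_true, RCEval.reachB_iff, RCEval.reachB_iff, RCEval.reachB_iff]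
  rfl

/-- `conf t ∈ {oc|ab}` iff `p7`. [folklore] -/
theorem mem7 (t : Finset (Fin 6)) :
    c6.conf t ∈ openConn (0 : Fin 6) 2 ∩ openConn (3 : Fin 6) 1 ∩ (sepEv (1 : Fin 6) 2 : Set (BondConfig (Fin 6))) ↔
      p7 t = true := by
  unfold p7
  rw [Set.mem_inter_iff, Set.mem_inter_iff, mem_sepEv_iff, Bool.and_eq_true, Bool.and_eq_true, Bool.not_eq_true',
    ← Bool.not_eq_true, RCEval.reachB_iff, RCEval.reachB_iff, RCEval.reachB_iff]
  rfl

/-- `conf t ∈ {oab|c}` iff `p3`. [folklore] -/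
theorem mem3 (t : Finset (Fin 6)) :
    c6.conf t ∈ openConn (0 : Fin 6) 1 ∩ openConn (3 : Fin 6) 1 ∩ (sepEv (1 : Fin 6) 2 : Set (BondConfig (Fin 6))) ↔
      p3 t = true := by
  unfold p3
  rw [Set.mem_inter_iff, Set.mem_inter_iff, mem_sepEv_iff, Bool.and_eq_true, Bool.and_eq_true, Bool.not_eq_true',
    ← Bool.not_eq_true, RCEval.reachB_iff, RCEval.reachB_iff, RCEval.reachB_iff]
  rfl

/-- `conf t ∈ {ocb|a}` iff `p4`. [folklore] -/
theorem mem4 (t : Finset (Fin 6)) :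
    c6.conf t ∈ openConn (0 : Fin 6) 2 ∩ openConn (3 : Fin 6) 2 ∩ (sepEv (1 : Fin 6) 2 : Set (BondConfig (Fin 6))) ↔
      p4 t = true := by
  unfold p4
  rw [Set.mem_inter_iff, Set.mem_inter_iff, mem_sepEv_iff, Bool.and_eq_true, Bool.and_eq_true, Bool.not_eq_true',
    ← Bool.not_eq_true, RCEval.reachB_iff, RCEval.reachB_iff, RCEval.reachB_iff]
  rfl

/-- `x₆·Z = (4h(2) + 4h(3) + h(4))/64`. [cite: Grimmett2006, §1.4 eq. (1.20) (p. 15)] -/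
theorem sum6 (h : ℕ → ℝ) : ∑ j ∈ Finset.range (c6.n + 1), (c6.levQ p6 j : ℝ) * h j = h 2 / 16 + h 3 / 16 + h 4 / 64 := by
  obtain ⟨e0, e1, e2, e3, e4, e5, e6⟩ := lev6
  simp only [show c6.n + 1 = 7 from rfl, Finset.sum_range_succ, Finset.sum_range_zero, e0, e1, e2, e3, e4, e5, e6]
  push_cast
  ring

/-- `x₇·Z = h(2)/64`. [cite: Grimmett2006, §1.4 eq. (1.20) (p. 15)] -/
theorem sum7 (h : ℕ → ℝ) : ∑ j ∈ Finset.range (c6.n + 1), (c6.levQ p7 j : ℝ) * h j = h 2 / 64 := by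
  obtain ⟨e0, e1, e2, e3, e4, e5, e6⟩ := lev7
  simp only [show c6.n + 1 = 7 from rfl, Finset.sum_range_succ, Finset.sum_range_zero, e0, e1, e2, e3, e4, e5, e6]
  push_cast
  ring

/-- `x₃·Z = (2h(2) + h(3))/64`. [cite: Grimmett2006, §1.4 eq. (1.20) (p. 15)] -/
theorem sum3 (h : ℕ → ℝ) : ∑ j ∈ Finset.range (c6.n + 1), (c6.levQ p3 j : ℝ) * h j = h 2 / 32 + h 3 / 64 := by
  obtain ⟨e0, e1, e2, e3, e4, e5, e6⟩ := lev3
  simp only [show c6.n + 1 = 7 from rfl, Finset.sum_range_succ, Finset.sum_range_zero, e0, e1, e2, e3, e4, e5, e6]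
  push_cast
  ring

/-- `x₄·Z = (2h(2) + h(3))/64`. [cite: Grimmett2006, §1.4 eq. (1.20) (p. 15)] -/
theorem sum4 (h : ℕ → ℝ) : ∑ j ∈ Finset.range (c6.n + 1), (c6.levQ p4 j : ℝ) * h j = h 2 / 32 + h 3 / 64 := by
  obtain ⟨e0, e1, e2, e3, e4, e5, e6⟩ := lev4
  simp only [show c6.n + 1 = 7 from rfl, Finset.sum_range_succ, Finset.sum_range_zero, e0, e1, e2, e3, e4, e5, e6]
  push_cast
  ring

end

end FourPointC6

noncomputable section

open scoped Classical
open FourPointC6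

/-! ### The four-point inequality on the 6-cycle ⟺ log-concavity of the count weight at the middle level -/

/-- **Kozma–Nitzan's four-point inequality under `μ_h ∝ P_½·h(k)` on the 6-cycle `o–a–x–b–c–y–o` is EQUIVALENT to
`h(2)·h(4) ≤ h(3)²`** (every positive `h`).  Precisely `x₃x₄ − x₆x₇ = (h(3)² − h(2)h(4))/(4096·Z²)`.  For `h = q^k` this is an
EQUALITY: the 6-cycle is a tight cell of `FourPointFK q` for every `q > 0`. [cite: KozmaNitzan2024, Thm. 1, eq. (6) (pp. 7–8)]
[cite: Grimmett2006, §1.4 eq. (1.20) (p. 15); §3.9 (pp. 63–65)] -/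
theorem fourPoint_c6_iff {h : ℕ → ℝ} (hpos : ∀ k, 0 < h k) :
    FourPointUnder (crMeasure c6.w h) (0 : Fin 6) 1 2 3 ↔ h 2 * h 4 ≤ h 3 ^ 2 := by
  unfold FourPointUnder
  rw [RCEval.cr_real_eq_levels_div valid hpos mem6, RCEval.cr_real_eq_levels_div valid hpos mem7,
    RCEval.cr_real_eq_levels_div valid hpos mem3, RCEval.cr_real_eq_levels_div valid hpos mem4, sum6 h, sum7 h, sum3 h, sum4 h]
  have hZ : 0 < crPartition c6.w h := crPartition_pos c6.w hpos
  rw [div_mul_div_comm, div_mul_div_comm, div_le_div_iff_of_pos_right (mul_pos hZ hZ)]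
  have h2 := hpos 2
  have h3 := hpos 3
  have h4 := hpos 4
  constructor
  · intro H
    nlinarith [H]
  · intro H
    nlinarith [H]

/-- **The 6-cycle is a tight cell of the four-point inequality for every random-cluster measure** (`h = q^k`: `q²·q⁴ = (q³)²`):
`FourPointUnder (φ_{½,q}) o a c b` holds (with equality) for every `q > 0`. [cite: KozmaNitzan2024, Thm. 1 (p. 7)] [cite: Grimmett2006, §3.9 (p. 63)] -/
theorem fourPoint_c6_rcMeasureW {q : ℝ} (hq : 0 < q) : FourPointUnder (rcMeasureW c6.w q ∅) (0 : Fin 6) 1 2 3 := by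
  rw [← crMeasure_pow_eq_rcMeasureW]
  refine (fourPoint_c6_iff (fun k => pow_pos hq k)).2 (le_of_eq ?_)
  ring

/-- **The four-point inequality FAILS under `P_½ · k!`** (`k!` is positive, increasing and log-convex: `3!² = 36 < 48 = 2!·4!`), on the
6-cycle — although additive gluing for `|A| ≤ 2` holds there (exact census of the seat).  So the KN route to additive gluing is closed for
log-convex count weights from BOTH sides (the conditioned hub inequality fails too, fk-1 g10). [cite: KozmaNitzan2024, Thm. 1 (p. 7)]
[cite: Grimmett2006, §3.9 (pp. 63–65)] -/
theorem not_fourPoint_count_factorial :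
    ¬ FourPointUnder (crMeasure c6.w (fun k => (k.factorial : ℝ))) (0 : Fin 6) 1 2 3 := by
  rw [fourPoint_c6_iff (fun k => by exact_mod_cast Nat.factorial_pos k)]
  norm_num [Nat.factorial]

/-- **Log-concavity at `3` is NECESSARY for the four-point inequality on all weighted graphs with six vertices**: if
`FourPointUnder (crMeasure w h) o a c b` holds for every `w` on `Fin 6` and all `o, a, c, b`, then `h(2)·h(4) ≤ h(3)²`.
[cite: KozmaNitzan2024, Thm. 1 (p. 7)] [cite: Grimmett2006, §3.9 (pp. 63–65)] -/
theorem logConcaveAt_three_of_fourPoint_fin_six {h : ℕ → ℝ} (hpos : ∀ k, 0 < h k)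
    (hfp : ∀ (w : Sym2 (Fin 6) → unitInterval) (o a c b : Fin 6), FourPointUnder (crMeasure w h) o a c b) :
    h 2 * h 4 ≤ h 3 ^ 2 :=
  (fourPoint_c6_iff hpos).1 (hfp c6.w 0 1 2 3)

/-- **The four-point inequality does not hold for every positive count weight** (contrast: additive gluing does in every census so far,
`AdditiveGluingCountPos`): any `h` with `h(3)² < h(2)·h(4)` violates it on the 6-cycle. [cite: KozmaNitzan2024, Thm. 1 (p. 7)] -/
theorem not_fourPoint_count_all :
    ¬ ∀ (n : ℕ) (w : Sym2 (Fin n) → unitInterval) (h : ℕ → ℝ), (∀ k, 0 < h k) →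
        ∀ o a c b : Fin n, FourPointUnder (crMeasure w h) o a c b := fun H =>
  not_fourPoint_count_factorial (H 6 c6.w _ (fun k => by exact_mod_cast Nat.factorial_pos k) 0 1 2 3)

/-- **RIGIDITY at the witnessed level**: if BOTH the hub inequality and the four-point inequality hold under `μ_h` on all finite weighted
graphs (all `Fin n`), then `h(3)² = h(2)·h(4)` — log-convexity at `3` from the hub on the path `Fin 4` (`logConvex_of_hub_all`, fk-1 g10)
and log-concavity at `3` from the four-point inequality on the 6-cycle.  The random-cluster weights `q^k` satisfy both with equality.
[cite: AyyerLinussonRavichandran2025, §7 eq. (15) (p. 22)] [cite: KozmaNitzan2024, Thm. 1 (p. 7)] [cite: Grimmett2006, §3.9 (pp. 63–65)] -/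
theorem geometric_of_hub_and_fourPoint {h : ℕ → ℝ} (hpos : ∀ k, 0 < h k)
    (hhub : ∀ (n : ℕ) (w : Sym2 (Fin n) → unitInterval) (o a b : Fin n), HubUnder (crMeasure w h) o a b)
    (hfp : ∀ (n : ℕ) (w : Sym2 (Fin n) → unitInterval) (o a c b : Fin n), FourPointUnder (crMeasure w h) o a c b) :
    h 3 ^ 2 = h 2 * h 4 := by
  have hconv := logConvex_of_hub_all hpos hhub (m := 3) (by norm_num)
  have hconc := logConcaveAt_three_of_fourPoint_fin_six hpos (hfp 6)
  norm_num at hconv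
  nlinarith [hconv, hconc]

end

end FK

end Summit.CriticalPhenomena.PercolationContinuityZ3.Theorems
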